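import Summits.MatrixMultiplication.MatrixMultiplication.Theorems.SoloInformedTwistedTPPStructure

/-!
# Translation rigidity for a flat base (Lemma R′ of the flat-slice theorem)

This work, §8.4c. In the cyclic model with multipliers `{±1}`, if one slice `j₀` is holonomy-flat,
then after gauging `c(k,i) = ±(f_i + l_k)` with `f = ±a(·,j₀)`, `l = ±b(j₀,·)`, and for every other
`j` the pair `(u, v) = (a(·,j), b(j,·))` satisfies `|f_i + l_k| ∈ {|u_i + v_k|, |u_i - v_k|}` for all
`i, k` (sign classes `|x| = {x, -x}`). LEMMA R′ says that such a pair is a TRANSLATE of the base: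
there is `t` with `v_k = ±(l_k - t)` for every `k` and `u_i = ±(f_i + t)` for all but `≤ 8μ` indices,
where `μ` bounds the level sets of `f` — provided `l` is not constant, `8μ < |I|`, and doubling is
injective on the value group (odd order). This is the engine of THEOREM 8.7 (a flat slice forces
rank `≥ n²/10`), reducing Lemma L at `m = 2` to totally non-flat data.

We take the hypothesis in its unfolded four-case form
`(u_i - f_i ∈ {v_k + l_k, -v_k + l_k}) ∨ (u_i + f_i ∈ {v_k - l_k, -v_k - l_k})`
(`hW`), which is what the four sign cases of `f_i + l_k = ±(u_i ± v_k)` say; `pm_cases` records the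
translation from the sign-class form.
-/

namespace Summit.MatrixMultiplication.MatrixMultiplication.Theorems.TwistedTPP

open Finset
open scoped Classical

section Rigidity

variable {S I K : Type*} [AddCommGroup S] [Fintype I]

/-- The four sign cases of `|f + l| = |u ± v|`, rearranged: `u - f ∈ {v + l, -v + l}` or
`u + f ∈ {v - l, -v - l}`. -/
theorem pm_cases {f l u v : S} (h : pm (f + l) (u + v) ∨ pm (f + l) (u - v)) :
    (u - f = v + l ∨ u - f = -v + l) ∨ (u + f = v - l ∨ u + f = -v - l) := by
  unfold pm at h
  rcases h with (h | h) | (h | h)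
  · left; right; linear_combination (norm := abel1) -h
  · right; right; linear_combination (norm := abel1) h
  · left; left; linear_combination (norm := abel1) -h
  · right; left; linear_combination (norm := abel1) h

variable (f u : I → S) (l v : K → S) (μ : ℕ)

/-- Exceptional indices are few: a joint level set `{u - f = t, u + f = y}` lies in one level set of
`f` (doubling injective), hence has `≤ μ` elements. -/
theorem card_joint_level_le (h2 : ∀ x y : S, x + x = y + y → x = y)
    (hμ : ∀ x : S, (univ.filter fun i => f i = x).card ≤ μ) (t y : S) :
    (univ.filter fun i => u i - f i = t ∧ u i + f i = y).card ≤ μ := by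
  by_cases hne : (univ.filter fun i => u i - f i = t ∧ u i + f i = y).Nonempty
  · obtain ⟨i₀, hi₀⟩ := hne
    simp only [mem_filter, mem_univ, true_and] at hi₀
    refine le_trans (card_le_card ?_) (hμ (f i₀))
    intro i hi
    simp only [mem_filter, mem_univ, true_and] at hi ⊢
    apply h2
    linear_combination (norm := abel1) hi.2 - hi.1 - hi₀.2 + hi₀.1
  · rw [not_nonempty_iff_eq_empty.mp hne]; simp

/-- A big `(u - f)`-level `t` (more than `2μ` indices) must be matched by the first alternative at
EVERY `k`: `t ∈ {v_k + l_k, -v_k + l_k}`. -/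
theorem big_minus_level (h2 : ∀ x y : S, x + x = y + y → x = y)
    (hμ : ∀ x : S, (univ.filter fun i => f i = x).card ≤ μ)
    (hW : ∀ i k, (u i - f i = v k + l k ∨ u i - f i = -v k + l k) ∨
      (u i + f i = v k - l k ∨ u i + f i = -v k - l k))
    {t : S} (ht : 2 * μ < (univ.filter fun i => u i - f i = t).card) (k : K) :
    t = v k + l k ∨ t = -v k + l k := by
  by_contra hnot
  push Not at hnot
  have hsub : (univ.filter fun i => u i - f i = t) ⊆
      (univ.filter fun i => u i - f i = t ∧ u i + f i = v k - l k) ∪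
      (univ.filter fun i => u i - f i = t ∧ u i + f i = -v k - l k) := by
    intro i hi
    simp only [mem_filter, mem_univ, true_and, mem_union] at hi ⊢
    rcases hW i k with (h | h) | (h | h)
    · exact absurd (hi ▸ h) hnot.1
    · exact absurd (hi ▸ h) hnot.2
    · exact Or.inl ⟨hi, h⟩
    · exact Or.inr ⟨hi, h⟩
  have h1 := card_joint_level_le f u μ h2 hμ t (v k - l k)
  have h2' := card_joint_level_le f u μ h2 hμ t (-v k - l k)
  have := (card_le_card hsub).trans (card_union_le _ _)
  omega

/-- A big `(u + f)`-level `y` must be matched by the second alternative at every `k`: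
`y ∈ {v_k - l_k, -v_k - l_k}`. -/
theorem big_plus_level (h2 : ∀ x y : S, x + x = y + y → x = y)
    (hμ : ∀ x : S, (univ.filter fun i => f i = x).card ≤ μ)
    (hW : ∀ i k, (u i - f i = v k + l k ∨ u i - f i = -v k + l k) ∨
      (u i + f i = v k - l k ∨ u i + f i = -v k - l k))
    {y : S} (hy : 2 * μ < (univ.filter fun i => u i + f i = y).card) (k : K) :
    y = v k - l k ∨ y = -v k - l k := by
  by_contra hnot
  push Not at hnot
  have hsub : (univ.filter fun i => u i + f i = y) ⊆
      (univ.filter fun i => u i - f i = v k + l k ∧ u i + f i = y) ∪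
      (univ.filter fun i => u i - f i = -v k + l k ∧ u i + f i = y) := by
    intro i hi
    simp only [mem_filter, mem_univ, true_and, mem_union] at hi ⊢
    rcases hW i k with (h | h) | (h | h)
    · exact Or.inl ⟨h, hi⟩
    · exact Or.inr ⟨h, hi⟩
    · exact absurd (hi ▸ h) hnot.1
    · exact absurd (hi ▸ h) hnot.2
  have h1 := card_joint_level_le f u μ h2 hμ (v k + l k) y
  have h2' := card_joint_level_le f u μ h2 hμ (-v k + l k) y
  have := (card_le_card hsub).trans (card_union_le _ _)
  omega

/-- **Lemma R′ (translation rigidity for a flat base).** [this work, §8.4c] -/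
theorem translation_rigidity (h2 : ∀ x y : S, x + x = y + y → x = y)
    (hμ : ∀ x : S, (univ.filter fun i => f i = x).card ≤ μ)
    (hl : ∃ k k' : K, l k ≠ l k') (hn : 8 * μ < Fintype.card I)
    (hW : ∀ i k, (u i - f i = v k + l k ∨ u i - f i = -v k + l k) ∨
      (u i + f i = v k - l k ∨ u i + f i = -v k - l k)) :
    ∃ t : S, (∀ k, pm (v k) (l k - t)) ∧
      (univ.filter fun i => ¬ pm (u i) (f i + t)).card ≤ 8 * μ := by
  obtain ⟨k₁, k₂, hk⟩ := hl
  have BM := fun {t : S} (ht : 2 * μ < (univ.filter fun i => u i - f i = t).card) =>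
    big_minus_level f u l v μ h2 hμ hW ht
  have BP := fun {y : S} (hy : 2 * μ < (univ.filter fun i => u i + f i = y).card) =>
    big_plus_level f u l v μ h2 hμ hW hy
  -- at most one big minus-level
  have UM : ∀ {t₁ t₂ : S}, 2 * μ < (univ.filter fun i => u i - f i = t₁).card →
      2 * μ < (univ.filter fun i => u i - f i = t₂).card → t₁ = t₂ := by
    intro t₁ t₂ h₁ h₂
    by_contra hne
    apply hk; apply h2
    have H : ∀ k, l k + l k = t₁ + t₂ := by
      intro k
      rcases BM h₁ k with e₁ | e₁ <;> rcases BM h₂ k with e₂ | e₂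
      · exact absurd (e₁.trans e₂.symm) hne
      · linear_combination (norm := abel1) -e₁ - e₂
      · linear_combination (norm := abel1) -e₁ - e₂
      · exact absurd (e₁.trans e₂.symm) hne
    rw [H k₁, H k₂]
  -- at most one big plus-level
  have UP : ∀ {y₁ y₂ : S}, 2 * μ < (univ.filter fun i => u i + f i = y₁).card →
      2 * μ < (univ.filter fun i => u i + f i = y₂).card → y₁ = y₂ := by
    intro y₁ y₂ h₁ h₂
    by_contra hne
    apply hk; apply h2
    have H : ∀ k, l k + l k = -(y₁ + y₂) := by
      intro k
      rcases BP h₁ k with e₁ | e₁ <;> rcases BP h₂ k with e₂ | e₂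
      · exact absurd (e₁.trans e₂.symm) hne
      · linear_combination (norm := abel1) e₁ + e₂
      · linear_combination (norm := abel1) e₁ + e₂
      · exact absurd (e₁.trans e₂.symm) hne
    rw [H k₁, H k₂]
  -- compatibility of a big minus-level `t` with a big plus-level `y`: `y = -t`
  have CP : ∀ {t y : S}, 2 * μ < (univ.filter fun i => u i - f i = t).card →
      2 * μ < (univ.filter fun i => u i + f i = y).card → y = -t := by
    intro t y ht hy
    by_contra hne
    apply hk; apply h2
    have H : ∀ k, l k + l k = t - y := by
      intro k
      rcases BM ht k with e₁ | e₁ <;> rcases BP hy k with e₂ | e₂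
      · linear_combination (norm := abel1) -e₁ + e₂
      · exact absurd (by linear_combination (norm := abel1) e₁ + e₂ : y = -t) hne
      · exact absurd (by linear_combination (norm := abel1) e₁ + e₂ : y = -t) hne
      · linear_combination (norm := abel1) -e₁ + e₂
    rw [H k₁, H k₂]
  -- choose the shift `t`
  have key : ∃ t : S,
      (∀ x, 2 * μ < (univ.filter fun i => u i - f i = x).card → x = t) ∧
      (∀ y, 2 * μ < (univ.filter fun i => u i + f i = y).card → y = -t) ∧
      (2 * μ < (univ.filter fun i => u i - f i = t).card ∨
        2 * μ < (univ.filter fun i => u i + f i = -t).card) := by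
    by_cases hm : ∃ x, 2 * μ < (univ.filter fun i => u i - f i = x).card
    · obtain ⟨t, ht⟩ := hm
      exact ⟨t, fun x hx => UM hx ht, fun y hy => CP ht hy, Or.inl ht⟩
    · push Not at hm
      by_cases hp : ∃ y, 2 * μ < (univ.filter fun i => u i + f i = y).card
      · obtain ⟨y, hy⟩ := hp
        refine ⟨-y, fun x hx => absurd (hm x) (not_le.mpr hx), fun y' hy' => ?_, Or.inr ?_⟩
        · rw [neg_neg]; exact UP hy' hy
        · rw [neg_neg]; exact hy
      · push Not at hp
        exfalso
        -- all four covering sets at `k₁` are small: contradiction with `8μ < |I|`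
        have hcov : (univ : Finset I) ⊆
            (((univ.filter fun i => u i - f i = v k₁ + l k₁) ∪
              (univ.filter fun i => u i - f i = -v k₁ + l k₁)) ∪
              (univ.filter fun i => u i + f i = v k₁ - l k₁)) ∪
              (univ.filter fun i => u i + f i = -v k₁ - l k₁) := by
          intro i _
          simp only [mem_union, mem_filter, mem_univ, true_and]
          rcases hW i k₁ with (h | h) | (h | h)
          · exact Or.inl (Or.inl (Or.inl h))
          · exact Or.inl (Or.inl (Or.inr h))
          · exact Or.inl (Or.inr h)
          · exact Or.inr h
        have c1 := hm (v k₁ + l k₁)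
        have c2 := hm (-v k₁ + l k₁)
        have c3 := hp (v k₁ - l k₁)
        have c4 := hp (-v k₁ - l k₁)
        have hc := card_le_card hcov
        have u1 := card_union_le
          (((univ.filter fun i => u i - f i = v k₁ + l k₁) ∪
            (univ.filter fun i => u i - f i = -v k₁ + l k₁)) ∪
            (univ.filter fun i => u i + f i = v k₁ - l k₁))
          (univ.filter fun i => u i + f i = -v k₁ - l k₁)
        have u2 := card_union_le
          ((univ.filter fun i => u i - f i = v k₁ + l k₁) ∪
            (univ.filter fun i => u i - f i = -v k₁ + l k₁))
          (univ.filter fun i => u i + f i = v k₁ - l k₁)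
        have u3 := card_union_le (univ.filter fun i => u i - f i = v k₁ + l k₁)
          (univ.filter fun i => u i - f i = -v k₁ + l k₁)
        rw [card_univ] at hc
        omega
  obtain ⟨t, htm, htp, hbig⟩ := key
  refine ⟨t, ?_, ?_⟩
  · -- the `v`-part
    intro k
    unfold pm
    rcases hbig with hb | hb
    · rcases BM hb k with e | e
      · right; linear_combination (norm := abel1) -e
      · left; linear_combination (norm := abel1) e
    · rcases BP hb k with e | e
      · left; linear_combination (norm := abel1) -e
      · right; linear_combination (norm := abel1) e
  · -- the count: the bad set meets each of the four covering sets (at `k₁`) in ≤ 2μ elements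
    set Bad := (univ.filter fun i => ¬ pm (u i) (f i + t)) with hBad
    have HM : ∀ x : S, ((univ.filter fun i => u i - f i = x) ∩ Bad).card ≤ 2 * μ := by
      intro x
      by_cases hx : 2 * μ < (univ.filter fun i => u i - f i = x).card
      · have hxt := htm x hx
        have : (univ.filter fun i => u i - f i = x) ∩ Bad = ∅ := by
          apply eq_empty_of_forall_notMem
          intro i hi
          simp only [hBad, mem_inter, mem_filter, mem_univ, true_and, pm] at hi
          exact hi.2 (Or.inl (by linear_combination (norm := abel1) hi.1 + hxt))
        rw [this]; simp
      · exact (card_le_card inter_subset_left).trans (not_lt.mp hx)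
    have HP : ∀ y : S, ((univ.filter fun i => u i + f i = y) ∩ Bad).card ≤ 2 * μ := by
      intro y
      by_cases hy : 2 * μ < (univ.filter fun i => u i + f i = y).card
      · have hyt := htp y hy
        have : (univ.filter fun i => u i + f i = y) ∩ Bad = ∅ := by
          apply eq_empty_of_forall_notMem
          intro i hi
          simp only [hBad, mem_inter, mem_filter, mem_univ, true_and, pm] at hi
          exact hi.2 (Or.inr (by linear_combination (norm := abel1) hi.1 + hyt))
        rw [this]; simp
      · exact (card_le_card inter_subset_left).trans (not_lt.mp hy)
    have hcov : Bad ⊆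
        ((((univ.filter fun i => u i - f i = v k₁ + l k₁) ∩ Bad) ∪
          ((univ.filter fun i => u i - f i = -v k₁ + l k₁) ∩ Bad)) ∪
          ((univ.filter fun i => u i + f i = v k₁ - l k₁) ∩ Bad)) ∪
          ((univ.filter fun i => u i + f i = -v k₁ - l k₁) ∩ Bad) := by
      intro i hi
      simp only [mem_union, mem_inter, mem_filter, mem_univ, true_and]
      rcases hW i k₁ with (h | h) | (h | h)
      · exact Or.inl (Or.inl (Or.inl ⟨h, hi⟩))
      · exact Or.inl (Or.inl (Or.inr ⟨h, hi⟩))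
      · exact Or.inl (Or.inr ⟨h, hi⟩)
      · exact Or.inr ⟨h, hi⟩
    have c1 := HM (v k₁ + l k₁)
    have c2 := HM (-v k₁ + l k₁)
    have c3 := HP (v k₁ - l k₁)
    have c4 := HP (-v k₁ - l k₁)
    have hc := card_le_card hcov
    have u1 := card_union_le
      ((((univ.filter fun i => u i - f i = v k₁ + l k₁) ∩ Bad) ∪
        ((univ.filter fun i => u i - f i = -v k₁ + l k₁) ∩ Bad)) ∪
        ((univ.filter fun i => u i + f i = v k₁ - l k₁) ∩ Bad))
      ((univ.filter fun i => u i + f i = -v k₁ - l k₁) ∩ Bad)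
    have u2 := card_union_le
      (((univ.filter fun i => u i - f i = v k₁ + l k₁) ∩ Bad) ∪
        ((univ.filter fun i => u i - f i = -v k₁ + l k₁) ∩ Bad))
      ((univ.filter fun i => u i + f i = v k₁ - l k₁) ∩ Bad)
    have u3 := card_union_le ((univ.filter fun i => u i - f i = v k₁ + l k₁) ∩ Bad)
      ((univ.filter fun i => u i - f i = -v k₁ + l k₁) ∩ Bad)
    omega

/-! ### Twisted base: a non-flat base kills translation (route (R2) of §8.4c)

For a general base slice the classes are `|f_i + κ_{ik} l_k|` with inner signs `κ_{ik} = ±1`; we encode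
the signed base row as `lk i k ∈ {l k, -l k}`. If a column `(u,v)` is a translate by `t` on a big level
set of `u - f`, then at every `k` with `l k ≠ 0` either `t = 0` or all non-exceptional rows of the level
carry the SAME sign `lk · k`: two rows with opposite signs would put `t` in
`{±v_k + l_k} ∩ {±v_k - l_k} ⊆ {0}` (doubling injective). -/

/-- **Non-flat base kills translation** [this work, §8.4c (R2)]. With signed base entries
`lk i k ∈ {l k, -l k}`, the four-case hypothesis for a column `(u, v)`, a shift `t ≠ 0` and a column
index `k` with `l k ≠ 0`: any two rows `i₁, i₂` of the level set `{u - f = t}` that are not exceptional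
at `k` (exceptional = the second alternative `u + f ∈ {±v_k ± l_k}` is available) have
`lk i₁ k = lk i₂ k`; and the exceptional rows number at most `4μ`. -/
theorem twisted_base_sign_constant (h2 : ∀ x y : S, x + x = y + y → x = y)
    (hμ : ∀ x : S, (univ.filter fun i => f i = x).card ≤ μ) (lk : I → K → S)
    (hlk : ∀ i k, lk i k = l k ∨ lk i k = -l k)
    (hW : ∀ i k, (u i - f i = v k + lk i k ∨ u i - f i = -v k + lk i k) ∨
      (u i + f i = v k - lk i k ∨ u i + f i = -v k - lk i k))
    {t : S} (ht : t ≠ 0) {k : K} (hk : l k ≠ 0) :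
    (univ.filter fun i => u i - f i = t ∧ (u i + f i = v k - l k ∨ u i + f i = -v k - l k ∨
        u i + f i = v k + l k ∨ u i + f i = -v k + l k)).card ≤ 4 * μ ∧
    ∀ i₁ i₂ : I, u i₁ - f i₁ = t → u i₂ - f i₂ = t →
      ¬ (u i₁ + f i₁ = v k - l k ∨ u i₁ + f i₁ = -v k - l k ∨
          u i₁ + f i₁ = v k + l k ∨ u i₁ + f i₁ = -v k + l k) →
      ¬ (u i₂ + f i₂ = v k - l k ∨ u i₂ + f i₂ = -v k - l k ∨
          u i₂ + f i₂ = v k + l k ∨ u i₂ + f i₂ = -v k + l k) →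
      lk i₁ k = lk i₂ k := by
  refine ⟨?_, ?_⟩
  · -- the exceptional rows lie in four joint level sets, each of size ≤ μ
    have hsub : (univ.filter fun i => u i - f i = t ∧ (u i + f i = v k - l k ∨
          u i + f i = -v k - l k ∨ u i + f i = v k + l k ∨ u i + f i = -v k + l k)) ⊆
        (((univ.filter fun i => u i - f i = t ∧ u i + f i = v k - l k) ∪
          (univ.filter fun i => u i - f i = t ∧ u i + f i = -v k - l k)) ∪
          (univ.filter fun i => u i - f i = t ∧ u i + f i = v k + l k)) ∪
          (univ.filter fun i => u i - f i = t ∧ u i + f i = -v k + l k) := by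
      intro i hi
      simp only [mem_filter, mem_univ, true_and, mem_union] at hi ⊢
      rcases hi.2 with h | h | h | h
      · exact Or.inl (Or.inl (Or.inl ⟨hi.1, h⟩))
      · exact Or.inl (Or.inl (Or.inr ⟨hi.1, h⟩))
      · exact Or.inl (Or.inr ⟨hi.1, h⟩)
      · exact Or.inr ⟨hi.1, h⟩
    have c1 := card_joint_level_le f u μ h2 hμ t (v k - l k)
    have c2 := card_joint_level_le f u μ h2 hμ t (-v k - l k)
    have c3 := card_joint_level_le f u μ h2 hμ t (v k + l k)
    have c4 := card_joint_level_le f u μ h2 hμ t (-v k + l k)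
    have hc := card_le_card hsub
    have u1 := card_union_le
      (((univ.filter fun i => u i - f i = t ∧ u i + f i = v k - l k) ∪
        (univ.filter fun i => u i - f i = t ∧ u i + f i = -v k - l k)) ∪
        (univ.filter fun i => u i - f i = t ∧ u i + f i = v k + l k))
      (univ.filter fun i => u i - f i = t ∧ u i + f i = -v k + l k)
    have u2 := card_union_le
      ((univ.filter fun i => u i - f i = t ∧ u i + f i = v k - l k) ∪
        (univ.filter fun i => u i - f i = t ∧ u i + f i = -v k - l k))
      (univ.filter fun i => u i - f i = t ∧ u i + f i = v k + l k)
    have u3 := card_union_le (univ.filter fun i => u i - f i = t ∧ u i + f i = v k - l k)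
      (univ.filter fun i => u i - f i = t ∧ u i + f i = -v k - l k)
    omega
  · intro i₁ i₂ h₁ h₂ hn₁ hn₂
    -- both rows use the first alternative: t = ±v k + lk i k
    have e₁ : t = v k + lk i₁ k ∨ t = -v k + lk i₁ k := by
      rcases hW i₁ k with (h | h) | (h | h)
      · exact Or.inl (h₁.symm.trans h)
      · exact Or.inr (h₁.symm.trans h)
      · exfalso; apply hn₁
        rcases hlk i₁ k with e | e
        · exact Or.inl (by rw [h, e])
        · exact Or.inr (Or.inr (Or.inl (by rw [h, e]; abel)))
      · exfalso; apply hn₁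
        rcases hlk i₁ k with e | e
        · exact Or.inr (Or.inl (by rw [h, e]))
        · exact Or.inr (Or.inr (Or.inr (by rw [h, e]; abel)))
    have e₂ : t = v k + lk i₂ k ∨ t = -v k + lk i₂ k := by
      rcases hW i₂ k with (h | h) | (h | h)
      · exact Or.inl (h₂.symm.trans h)
      · exact Or.inr (h₂.symm.trans h)
      · exfalso; apply hn₂
        rcases hlk i₂ k with e | e
        · exact Or.inl (by rw [h, e])
        · exact Or.inr (Or.inr (Or.inl (by rw [h, e]; abel)))
      · exfalso; apply hn₂
        rcases hlk i₂ k with e | e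
        · exact Or.inr (Or.inl (by rw [h, e]))
        · exact Or.inr (Or.inr (Or.inr (by rw [h, e]; abel)))
    -- if the signs differ, t ∈ {±v + l} ∩ {±v - l} forces t = 0 or l k = 0
    by_contra hne
    have hopp : lk i₂ k = -lk i₁ k := by
      rcases hlk i₁ k with a | a <;> rcases hlk i₂ k with b | b
      · exact absurd (a.trans b.symm) hne
      · rw [a, b]
      · rw [a, b, neg_neg]
      · exact absurd (a.trans b.symm) hne
    have hl1 : lk i₁ k ≠ 0 := by
      rcases hlk i₁ k with a | a
      · rw [a]; exact hk
      · rw [a]; exact neg_ne_zero.mpr hk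
    rcases e₁ with e₁ | e₁ <;> rcases e₂ with e₂ | e₂
    · -- v + l₁ = v - l₁ → l₁ = 0
      apply hl1; apply h2; rw [add_zero]; linear_combination (norm := abel1) e₂ - e₁ + hopp
    · -- v + l₁ = -v - l₁ → t = 0
      apply ht; apply h2; rw [add_zero]; linear_combination (norm := abel1) e₁ + e₂ + hopp
    · apply ht; apply h2; rw [add_zero]; linear_combination (norm := abel1) e₁ + e₂ + hopp
    · apply hl1; apply h2; rw [add_zero]; linear_combination (norm := abel1) e₂ - e₁ + hopp

end Rigidity

end Summit.MatrixMultiplication.MatrixMultiplication.Theorems.TwistedTPP
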